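import Literature.AlgebraicGeometry.Resolution.MonoidalTransformFrameStep
import HarnessLib

/-!
# One monoidal transform in the frame, WITH the bookkeeping of [CoP1] Prop. 8.1 (1): generators in `S₀[1/f]`

Topic: `Literature/AlgebraicGeometry/Resolution`. PROOF side of `CossartPiltant2019ReductionP`
(`ArithmeticalThreefoldsLocal.lean`), input (C4): the head of the decomposition layer of
[CoP1] Prop. 9.3 is [CoP1] Prop. 8.1 in the form of `exists_localUniformization_of_head'`
(`DecompositionLayerStrictParameters.lean`), whose clause (c′) — property (1) of Prop. 8.1
read for the models, "`(S₀)_f = S_f`" — asks that the final local uniformization be the local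
ring of a model `S[t′]` with `fⁿ t′ ⊆ R₁′`. The monoidal steps of `MonoidalTransformFrameStep.lean`
adjoin `z = x_b/x_a`; when `x_a` divides `f` in the current local ring (always the case in the
`E = F` reduction and in Lemma 8.2, where `a ∈ E`), `f·z` lies in the current local ring, hence
equals `y/s` with `y, s ∈ S[t]`, `v(s) = 0`, and ADJOINING `z·s = y/f` INSTEAD OF `z` gives the
same local ring (`locAtCentre_adjoin_insert_mul_eq`) while keeping the invariant
`∀ y ∈ t, ∃ n, fⁿ y ∈ R₀` for any subring `R₀ ∋ f` containing `S`. This file records the two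
steps in this TRACKED form (`exists_frameStepTracked_of_valuation_lt_one`, `…_eq_one`).

Everything is PROVED; no named facts, definitions, instances or notation are introduced.

## Sources

* V. Cossart, O. Piltant, J. Algebra 320 (2008) 1051–1082: Prop. 8.1 (1) and its proof (HAL
  hal-00139124, pp. 22–23). [CossartPiltant2008]
-/

noncomputable section

namespace Literature.AlgebraicGeometry.Resolution

universe u

open IsLocalRing _root_.Polynomial

section Tracked

variable {S : Type u} [CommRing S] [IsDomain S] [IsLocalRing S] {E : Type u} [Field E]
  [Algebra S E] [Algebra.IsAlgebraic S E]
  (hSuc : IsUniversallyCatenaryRing S) (hinj : Function.Injective (algebraMap S E))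
  (O : ValuationSubring E) (hSO : ∀ s : S, algebraMap S E s ∈ O)
  (hdom : ∀ s ∈ maximalIdeal S, O.valuation (algebraMap S E s) < 1)
  (hres : ∀ y : O, ∃ q : S[X], (∃ i, q.coeff i ∉ maximalIdeal S) ∧
    O.valuation (q.eval₂ (algebraMap S E) y) < 1)

omit [IsDomain S] [IsLocalRing S] [Algebra.IsAlgebraic S E] in
/-- If `S ⊆ R₀`, `f ∈ R₀` and every generator has `fⁿ z ∈ R₀`, then every element of the model
has (`DecompositionLayerStrictParameters.exists_pow_mul_mem_of_mem_adjoin`, private copy to keep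
imports light). [cite: CossartPiltant2008, Prop. 8.1 (1) (HAL p. 22)] -/
private theorem exists_pow_mul_mem_of_mem_adjoin' (R₀ : Subring E)
    (hSR : ∀ s : S, algebraMap S E s ∈ R₀) {f : E} (hf : f ∈ R₀) (t : Set E)
    (ht : ∀ z ∈ t, ∃ n : ℕ, f ^ n * z ∈ R₀) {y : E} (hy : y ∈ Algebra.adjoin S t) :
    ∃ n : ℕ, f ^ n * y ∈ R₀ := by
  let C : Subalgebra S E :=
    { carrier := {y | ∃ n : ℕ, f ^ n * y ∈ R₀}
      mul_mem' := by
        rintro a b ⟨m, hm⟩ ⟨n, hn⟩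
        exact ⟨m + n, by rw [pow_add, mul_mul_mul_comm]; exact R₀.mul_mem hm hn⟩
      one_mem' := ⟨0, by rw [pow_zero, one_mul]; exact R₀.one_mem⟩
      add_mem' := by
        rintro a b ⟨m, hm⟩ ⟨n, hn⟩
        refine ⟨m + n, ?_⟩
        rw [mul_add]
        refine R₀.add_mem ?_ ?_
        · rw [pow_add, mul_comm (f ^ m), mul_assoc]
          exact R₀.mul_mem (R₀.pow_mem hf n) hm
        · rw [pow_add, mul_assoc]
          exact R₀.mul_mem (R₀.pow_mem hf m) hn
      zero_mem' := ⟨0, by rw [mul_zero]; exact R₀.zero_mem⟩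
      algebraMap_mem' := fun s => ⟨0, by rw [pow_zero, one_mul]; exact hSR s⟩ }
  exact (Algebra.adjoin_le (S := C) ht) hy

omit [IsDomain S] [IsLocalRing S] [Algebra.IsAlgebraic S E] in
/-- Rescaling a new generator by a value-`0` element of `S[t]` does not change the local ring
(private copy of `locAtCentre_adjoin_insert_mul_eq`, `MonoidalTransformStep.lean`).
[cite: CossartPiltant2008, Prop. 8.1 (1) and §2.1 (HAL pp. 8–9, 22)] -/
private theorem locAtCentre_adjoin_insert_mul_eq' (t : Set E) (z s : E)
    (hs : s ∈ Algebra.adjoin S t) (hvs : O.valuation s = 1) :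
    locAtCentre (Algebra.adjoin S (insert (z * s) t)).toSubring O =
      locAtCentre (Algebra.adjoin S (insert z t)).toSubring O := by
  have key : ∀ (a b : E), b ∈ locAtCentre (Algebra.adjoin S (insert a t)).toSubring O →
      locAtCentre (Algebra.adjoin S (insert b t)).toSubring O ≤
        locAtCentre (Algebra.adjoin S (insert a t)).toSubring O := by
    intro a b hb
    have h1 : (Algebra.adjoin S (insert b t)).toSubring ≤
        locAtCentre (Algebra.adjoin S (insert a t)).toSubring O := by
      let C : Subalgebra S E :=
        { locAtCentre (Algebra.adjoin S (insert a t)).toSubring O with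
          algebraMap_mem' := fun r => le_locAtCentre _ _
            ((Algebra.adjoin S (insert a t)).algebraMap_mem r) }
      have : Algebra.adjoin S (insert b t) ≤ C := by
        refine Algebra.adjoin_le ?_
        rintro y (rfl | hy)
        · exact hb
        · exact le_locAtCentre _ _ (Algebra.subset_adjoin (Set.mem_insert_of_mem _ hy))
      exact fun y hy => this hy
    have h2 := locAtCentre_mono O h1
    rwa [locAtCentre_locAtCentre] at h2
  have hsz : s ∈ Algebra.adjoin S (insert z t) := Algebra.adjoin_mono (Set.subset_insert _ _) hs
  have hszs : s ∈ Algebra.adjoin S (insert (z * s) t) :=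
    Algebra.adjoin_mono (Set.subset_insert _ _) hs
  refine le_antisymm (key z (z * s) ?_) (key (z * s) z ?_)
  · exact Subring.mul_mem _ (le_locAtCentre _ _ (Algebra.subset_adjoin (Set.mem_insert _ _)))
      (le_locAtCentre _ _ hsz)
  · have hs0 : s ≠ 0 := ne_zero_of_valuation_eq_one hvs
    have hmem : (z * s) * s⁻¹ ∈ locAtCentre (Algebra.adjoin S (insert (z * s) t)).toSubring O :=
      Subring.mul_mem _ (le_locAtCentre _ _ (Algebra.subset_adjoin (Set.mem_insert _ _)))
        (inv_mem_locAtCentre (le_locAtCentre _ _ hszs) hvs)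
    rwa [mul_assoc, mul_inv_cancel₀ hs0, mul_one] at hmem

set_option maxHeartbeats 400000 in
omit [IsDomain S] [IsLocalRing S] [Algebra.IsAlgebraic S E] in
/-- **Transport of a regular system of parameters along an equality of local rings of
models.** [folklore] -/
private theorem transport_rsop {t₁ t₂ : Set E}
    (h₁ : (Algebra.adjoin S t₁).toSubring ≤ O.toSubring)
    (h₂ : (Algebra.adjoin S t₂).toSubring ≤ O.toSubring)
    (hEq : locAtCentre (Algebra.adjoin S t₁).toSubring O =
      locAtCentre (Algebra.adjoin S t₂).toSubring O)
    {d : ℕ} (x' : Fin d → locAtCentre (Algebra.adjoin S t₁).toSubring O)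
    (hspan : haveI := isLocalRing_locAtCentre h₁
      Ideal.span (Set.range x') = maximalIdeal _) :
    ∃ x'' : Fin d → locAtCentre (Algebra.adjoin S t₂).toSubring O,
      (∀ c, (x'' c : E) = (x' c : E)) ∧
      (haveI := isLocalRing_locAtCentre h₂
       Ideal.span (Set.range x'') = maximalIdeal _) := by
  haveI := isLocalRing_locAtCentre h₁
  haveI := isLocalRing_locAtCentre h₂
  let e : locAtCentre (Algebra.adjoin S t₁).toSubring O ≃+*
      locAtCentre (Algebra.adjoin S t₂).toSubring O :=
    { toFun := fun w => ⟨(w : E), hEq ▸ w.2⟩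
      invFun := fun w => ⟨(w : E), hEq.symm ▸ w.2⟩
      left_inv := fun _ => rfl
      right_inv := fun _ => rfl
      map_mul' := fun _ _ => rfl
      map_add' := fun _ _ => rfl }
  refine ⟨fun c => e (x' c), fun c => rfl, ?_⟩
  have hmap : (Ideal.span (Set.range x')).map e.toRingHom =
      Ideal.span (Set.range fun c => e (x' c)) := by
    rw [Ideal.map_span, ← Set.range_comp]
    rfl
  rw [← hmap, hspan]
  refine le_antisymm (fun y hy => ?_) (fun y hy => ?_)
  · obtain ⟨w, hw, rfl⟩ := (Ideal.mem_map_iff_of_surjective e.toRingHom e.surjective).mp hy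
    rw [mem_maximalIdeal_locAtCentre_iff h₂]
    exact (mem_maximalIdeal_locAtCentre_iff h₁ w).mp hw
  · have hvy : O.valuation (y : E) < 1 := (mem_maximalIdeal_locAtCentre_iff h₂ y).mp hy
    have : y = e.toRingHom (e.symm y) := (e.apply_symm_apply y).symm
    rw [this]
    exact Ideal.mem_map_of_mem _ ((mem_maximalIdeal_locAtCentre_iff h₁ _).mpr hvy)

set_option maxHeartbeats 800000 in
include hSuc hinj hSO hdom hres in
/-- **Tracked monoidal step, case `v(x_b/x_a) > 0`.** As
`exists_frameStep_of_valuation_lt_one`, for a subring `R₀ ∋ f` containing `S` and a model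
`S[t]` with `fⁿ t ⊆ R₀`, assuming `f · (x_b/x_a)` lies in the current local ring (e.g. `x_a ∣ f`):
the new model may be taken `S[t₁]`, `t ⊆ t₁` finite with `fⁿ t₁ ⊆ R₀`, its local ring being
the monoidal transform, regular, with regular parameters `x′` (`x′_c = x_c` for `c ≠ b`,
`x′_b = x_b/x_a`) and the monomial identity.
[cite: CossartPiltant2008, Prop. 8.1 (1) and proof (HAL pp. 22–23)] -/
theorem exists_frameStepTracked_of_valuation_lt_one {d : ℕ} (hSdim : ringKrullDim S = d)
    (R₀ : Subring E) (hSR₀ : ∀ s : S, algebraMap S E s ∈ R₀) (f : E) (hfR₀ : f ∈ R₀)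
    (t : Set E) (ht : t.Finite) (hTR : ∀ y ∈ t, ∃ n : ℕ, f ^ n * y ∈ R₀)
    (hTO : (Algebra.adjoin S t).toSubring ≤ O.toSubring)
    (hreg : IsRegularLocalRing (locAtCentre (Algebra.adjoin S t).toSubring O))
    (x : Fin d → locAtCentre (Algebra.adjoin S t).toSubring O)
    (hx : haveI := isLocalRing_locAtCentre hTO
      Ideal.span (Set.range x) = maximalIdeal _)
    (a b : Fin d) (hab : a ≠ b) (hlt : O.valuation ((x b : E) / (x a : E)) < 1)
    (hzf : (x b : E) / (x a : E) * f ∈ locAtCentre (Algebra.adjoin S t).toSubring O) :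
    ∃ (t₁ : Set E), t ⊆ t₁ ∧ t₁.Finite ∧ (∀ y ∈ t₁, ∃ n : ℕ, f ^ n * y ∈ R₀) ∧
      ∃ (hT₁O : (Algebra.adjoin S t₁).toSubring ≤ O.toSubring),
        IsRegularLocalRing (locAtCentre (Algebra.adjoin S t₁).toSubring O) ∧
        ∃ x' : Fin d → locAtCentre (Algebra.adjoin S t₁).toSubring O,
          (∀ c, c ≠ b → (x' c : E) = (x c : E)) ∧ ((x' b : E) = (x b : E) / (x a : E)) ∧
          (haveI := isLocalRing_locAtCentre hT₁O
           Ideal.span (Set.range x') = maximalIdeal _) ∧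
          ∀ α : Fin d → ℕ, (∏ c, (x c : E) ^ α c) =
            ∏ c, (x' c : E) ^ Function.update α a (α a + α b) c := by
  classical
  set z : E := (x b : E) / (x a : E) with hzdef
  obtain ⟨hT₁O, hreg₁, x', hx'c, hx'b, hspan, hmono⟩ :=
    exists_frameStep_of_valuation_lt_one hSuc hinj O hSO hdom hres hSdim t ht hTO hreg x hx a b
      hab hlt
  -- `f · z = y / s` with `y, s ∈ S[t]`, `v(s) = 0`; adjoin `z · s` instead of `z`
  obtain ⟨y, hy, s, hs, hvs, hzs⟩ := hzf
  have hzO : z ∈ O := (O.valuation_le_one_iff _).mp hlt.le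
  have hs0 : s ≠ 0 := ne_zero_of_valuation_eq_one hvs
  have hfzs : f * (z * s) = y := by
    have : z * f = y / s := hzs
    rw [← mul_assoc, mul_comm f z, this, div_mul_cancel₀ _ hs0]
  have hEq := locAtCentre_adjoin_insert_mul_eq' O t z s hs hvs
  have hT₂O : (Algebra.adjoin S (insert (z * s) t)).toSubring ≤ O.toSubring := by
    refine model_toSubring_le_valuationSubring O hSO (fun w hw => ?_)
    rcases hw with rfl | hw
    · exact O.mul_mem _ _ hzO (hTO hs)
    · exact hTO (Algebra.subset_adjoin hw)
  obtain ⟨x'', hx''E, hspan''⟩ := transport_rsop O hT₁O hT₂O hEq.symm x' hspan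
  refine ⟨insert (z * s) t, Set.subset_insert _ _, ht.insert _, ?_, hT₂O, ?_, x'',
    fun c hc => by rw [hx''E]; exact hx'c c hc, by rw [hx''E]; exact hx'b, hspan'',
    fun α => by simp_rw [hx''E]; exact hmono α⟩
  · rintro w (rfl | hw)
    · obtain ⟨n, hn⟩ := exists_pow_mul_mem_of_mem_adjoin' R₀ hSR₀ hfR₀ t hTR hy
      refine ⟨n + 1, ?_⟩
      rw [pow_succ, mul_assoc, hfzs]
      exact hn
    · exact hTR w hw
  · rw [hEq]; exact hreg₁

set_option maxHeartbeats 800000 in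
include hSuc hinj hSO hdom hres in
/-- **Tracked monoidal step, case `v(x_b/x_a) = 0`.** As `exists_frameStep_of_valuation_eq_one`
with the generator bookkeeping of `exists_frameStepTracked_of_valuation_lt_one`.
[cite: CossartPiltant2008, Prop. 8.1 (1) and proof (HAL pp. 22–23)] -/
theorem exists_frameStepTracked_of_valuation_eq_one {d : ℕ} (hSdim : ringKrullDim S = d)
    (R₀ : Subring E) (hSR₀ : ∀ s : S, algebraMap S E s ∈ R₀) (f : E) (hfR₀ : f ∈ R₀)
    (t : Set E) (ht : t.Finite) (hTR : ∀ y ∈ t, ∃ n : ℕ, f ^ n * y ∈ R₀)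
    (hTO : (Algebra.adjoin S t).toSubring ≤ O.toSubring)
    (hreg : IsRegularLocalRing (locAtCentre (Algebra.adjoin S t).toSubring O))
    (x : Fin d → locAtCentre (Algebra.adjoin S t).toSubring O)
    (hx : haveI := isLocalRing_locAtCentre hTO
      Ideal.span (Set.range x) = maximalIdeal _)
    (a b : Fin d) (hab : a ≠ b) (h1 : O.valuation ((x b : E) / (x a : E)) = 1)
    (hzf : (x b : E) / (x a : E) * f ∈ locAtCentre (Algebra.adjoin S t).toSubring O) :
    ∃ (t₁ : Set E), t ⊆ t₁ ∧ t₁.Finite ∧ (∀ y ∈ t₁, ∃ n : ℕ, f ^ n * y ∈ R₀) ∧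
      ∃ (hT₁O : (Algebra.adjoin S t₁).toSubring ≤ O.toSubring),
        IsRegularLocalRing (locAtCentre (Algebra.adjoin S t₁).toSubring O) ∧
        (x b : E) / (x a : E) ∈ locAtCentre (Algebra.adjoin S t₁).toSubring O ∧
        ∃ x' : Fin d → locAtCentre (Algebra.adjoin S t₁).toSubring O,
          (∀ c, c ≠ b → (x' c : E) = (x c : E)) ∧
          (haveI := isLocalRing_locAtCentre hT₁O
           Ideal.span (Set.range x') = maximalIdeal _) ∧
          ∀ α : Fin d → ℕ, (∏ c, (x c : E) ^ α c) =
            ((x b : E) / (x a : E)) ^ α b *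
              ∏ c, (x' c : E) ^ Function.update (Function.update α a (α a + α b)) b 0 c := by
  classical
  set z : E := (x b : E) / (x a : E) with hzdef
  obtain ⟨hT₁O, hreg₁, -, x', hx'c, hspan, hmono⟩ :=
    exists_frameStep_of_valuation_eq_one hSuc hinj O hSO hdom hres hSdim t ht hTO hreg x hx a b
      hab h1
  obtain ⟨y, hy, s, hs, hvs, hzs⟩ := hzf
  have hzO : z ∈ O := (O.valuation_le_one_iff _).mp h1.le
  have hs0 : s ≠ 0 := ne_zero_of_valuation_eq_one hvs
  have hfzs : f * (z * s) = y := by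
    have : z * f = y / s := hzs
    rw [← mul_assoc, mul_comm f z, this, div_mul_cancel₀ _ hs0]
  have hEq := locAtCentre_adjoin_insert_mul_eq' O t z s hs hvs
  have hT₂O : (Algebra.adjoin S (insert (z * s) t)).toSubring ≤ O.toSubring := by
    refine model_toSubring_le_valuationSubring O hSO (fun w hw => ?_)
    rcases hw with rfl | hw
    · exact O.mul_mem _ _ hzO (hTO hs)
    · exact hTO (Algebra.subset_adjoin hw)
  obtain ⟨x'', hx''E, hspan''⟩ := transport_rsop O hT₁O hT₂O hEq.symm x' hspan
  have hzmem : z ∈ locAtCentre (Algebra.adjoin S (insert (z * s) t)).toSubring O := by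
    rw [hEq]
    exact le_locAtCentre _ _ (Algebra.subset_adjoin (Set.mem_insert _ _))
  refine ⟨insert (z * s) t, Set.subset_insert _ _, ht.insert _, ?_, hT₂O, ?_, hzmem, x'',
    fun c hc => by rw [hx''E]; exact hx'c c hc, hspan'',
    fun α => by simp_rw [hx''E]; exact hmono α⟩
  · rintro w (rfl | hw)
    · obtain ⟨n, hn⟩ := exists_pow_mul_mem_of_mem_adjoin' R₀ hSR₀ hfR₀ t hTR hy
      refine ⟨n + 1, ?_⟩
      rw [pow_succ, mul_assoc, hfzs]
      exact hn
    · exact hTR w hw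
  · rw [hEq]; exact hreg₁

/-! ### The same steps, confined to a subfield

For the head of [CoP1] Prop. 9.3 the model generators must stay inside the given subfield
`K′` (`exists_localUniformization_of_head'`: `t′ ⊆ K′`). The steps adjoin `(x_b/x_a) · s` with
`x_a, x_b` in the local ring of `S[t]` and `s ∈ S[t]`, so they stay in any subfield `F ⊇ S ∪ t`. -/

omit [IsDomain S] [IsLocalRing S] [Algebra.IsAlgebraic S E] in
/-- The local ring of a model `S[t]` lies in every subfield containing `S` and `t`.
[cite: CossartPiltant2008, §2.1 (HAL pp. 8–9)] -/
theorem locAtCentre_adjoin_le_subfield (t : Set E) (F : Subfield E)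
    (hSF : ∀ s : S, algebraMap S E s ∈ F) (htF : t ⊆ F) :
    locAtCentre (Algebra.adjoin S t).toSubring O ≤ F.toSubring := by
  have hadj : (Algebra.adjoin S t).toSubring ≤ F.toSubring := by
    let C : Subalgebra S E :=
      { F.toSubring with
        algebraMap_mem' := fun s => hSF s }
    have : Algebra.adjoin S t ≤ C := Algebra.adjoin_le htF
    exact fun y hy => this hy
  rintro _ ⟨y, hy, z, hz, -, rfl⟩
  exact F.div_mem (hadj hy) (hadj hz)

set_option maxHeartbeats 800000 in
include hSuc hinj hSO hdom hres in
/-- `exists_frameStepTracked_of_valuation_lt_one`, with the new generators confined to a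
subfield `F ⊇ S ∪ t`. [cite: CossartPiltant2008, Prop. 8.1 (1) and proof (HAL pp. 22–23)] -/
theorem exists_frameStepTracked_of_valuation_lt_one_subset {d : ℕ} (hSdim : ringKrullDim S = d)
    (R₀ : Subring E) (hSR₀ : ∀ s : S, algebraMap S E s ∈ R₀) (f : E) (hfR₀ : f ∈ R₀)
    (F : Subfield E) (hSF : ∀ s : S, algebraMap S E s ∈ F)
    (t : Set E) (ht : t.Finite) (htF : t ⊆ F) (hTR : ∀ y ∈ t, ∃ n : ℕ, f ^ n * y ∈ R₀)
    (hTO : (Algebra.adjoin S t).toSubring ≤ O.toSubring)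
    (hreg : IsRegularLocalRing (locAtCentre (Algebra.adjoin S t).toSubring O))
    (x : Fin d → locAtCentre (Algebra.adjoin S t).toSubring O)
    (hx : haveI := isLocalRing_locAtCentre hTO
      Ideal.span (Set.range x) = maximalIdeal _)
    (a b : Fin d) (hab : a ≠ b) (hlt : O.valuation ((x b : E) / (x a : E)) < 1)
    (hzf : (x b : E) / (x a : E) * f ∈ locAtCentre (Algebra.adjoin S t).toSubring O) :
    ∃ (t₁ : Set E), t ⊆ t₁ ∧ t₁.Finite ∧ t₁ ⊆ F ∧ (∀ y ∈ t₁, ∃ n : ℕ, f ^ n * y ∈ R₀) ∧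
      ∃ (hT₁O : (Algebra.adjoin S t₁).toSubring ≤ O.toSubring),
        IsRegularLocalRing (locAtCentre (Algebra.adjoin S t₁).toSubring O) ∧
        ∃ x' : Fin d → locAtCentre (Algebra.adjoin S t₁).toSubring O,
          (∀ c, c ≠ b → (x' c : E) = (x c : E)) ∧ ((x' b : E) = (x b : E) / (x a : E)) ∧
          (haveI := isLocalRing_locAtCentre hT₁O
           Ideal.span (Set.range x') = maximalIdeal _) ∧
          ∀ α : Fin d → ℕ, (∏ c, (x c : E) ^ α c) =
            ∏ c, (x' c : E) ^ Function.update α a (α a + α b) c := by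
  classical
  set z : E := (x b : E) / (x a : E) with hzdef
  obtain ⟨hT₁O, hreg₁, x', hx'c, hx'b, hspan, hmono⟩ :=
    exists_frameStep_of_valuation_lt_one hSuc hinj O hSO hdom hres hSdim t ht hTO hreg x hx a b
      hab hlt
  -- `f · z = y / s` with `y, s ∈ S[t]`, `v(s) = 0`; adjoin `z · s` instead of `z`
  obtain ⟨y, hy, s, hs, hvs, hzs⟩ := hzf
  have hzO : z ∈ O := (O.valuation_le_one_iff _).mp hlt.le
  have hs0 : s ≠ 0 := ne_zero_of_valuation_eq_one hvs
  have hfzs : f * (z * s) = y := by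
    have : z * f = y / s := hzs
    rw [← mul_assoc, mul_comm f z, this, div_mul_cancel₀ _ hs0]
  have hEq := locAtCentre_adjoin_insert_mul_eq' O t z s hs hvs
  have hT₂O : (Algebra.adjoin S (insert (z * s) t)).toSubring ≤ O.toSubring := by
    refine model_toSubring_le_valuationSubring O hSO (fun w hw => ?_)
    rcases hw with rfl | hw
    · exact O.mul_mem _ _ hzO (hTO hs)
    · exact hTO (Algebra.subset_adjoin hw)
  obtain ⟨x'', hx''E, hspan''⟩ := transport_rsop O hT₁O hT₂O hEq.symm x' hspan
  have hRF := locAtCentre_adjoin_le_subfield O t F hSF htF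
  have hzsF : z * s ∈ F :=
    F.mul_mem (F.div_mem (hRF (x b).2) (hRF (x a).2)) (hRF (le_locAtCentre _ _ hs))
  refine ⟨insert (z * s) t, Set.subset_insert _ _, ht.insert _, Set.insert_subset hzsF htF, ?_,
    hT₂O, ?_, x'', fun c hc => by rw [hx''E]; exact hx'c c hc, by rw [hx''E]; exact hx'b, hspan'',
    fun α => by simp_rw [hx''E]; exact hmono α⟩
  · rintro w (rfl | hw)
    · obtain ⟨n, hn⟩ := exists_pow_mul_mem_of_mem_adjoin' R₀ hSR₀ hfR₀ t hTR hy
      refine ⟨n + 1, ?_⟩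
      rw [pow_succ, mul_assoc, hfzs]
      exact hn
    · exact hTR w hw
  · rw [hEq]; exact hreg₁

set_option maxHeartbeats 800000 in
include hSuc hinj hSO hdom hres in
/-- `exists_frameStepTracked_of_valuation_eq_one`, with the new generators confined to a
subfield `F ⊇ S ∪ t`. [cite: CossartPiltant2008, Prop. 8.1 (1) and proof (HAL pp. 22–23)] -/
theorem exists_frameStepTracked_of_valuation_eq_one_subset {d : ℕ} (hSdim : ringKrullDim S = d)
    (R₀ : Subring E) (hSR₀ : ∀ s : S, algebraMap S E s ∈ R₀) (f : E) (hfR₀ : f ∈ R₀)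
    (F : Subfield E) (hSF : ∀ s : S, algebraMap S E s ∈ F)
    (t : Set E) (ht : t.Finite) (htF : t ⊆ F) (hTR : ∀ y ∈ t, ∃ n : ℕ, f ^ n * y ∈ R₀)
    (hTO : (Algebra.adjoin S t).toSubring ≤ O.toSubring)
    (hreg : IsRegularLocalRing (locAtCentre (Algebra.adjoin S t).toSubring O))
    (x : Fin d → locAtCentre (Algebra.adjoin S t).toSubring O)
    (hx : haveI := isLocalRing_locAtCentre hTO
      Ideal.span (Set.range x) = maximalIdeal _)
    (a b : Fin d) (hab : a ≠ b) (h1 : O.valuation ((x b : E) / (x a : E)) = 1)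
    (hzf : (x b : E) / (x a : E) * f ∈ locAtCentre (Algebra.adjoin S t).toSubring O) :
    ∃ (t₁ : Set E), t ⊆ t₁ ∧ t₁.Finite ∧ t₁ ⊆ F ∧ (∀ y ∈ t₁, ∃ n : ℕ, f ^ n * y ∈ R₀) ∧
      ∃ (hT₁O : (Algebra.adjoin S t₁).toSubring ≤ O.toSubring),
        IsRegularLocalRing (locAtCentre (Algebra.adjoin S t₁).toSubring O) ∧
        (x b : E) / (x a : E) ∈ locAtCentre (Algebra.adjoin S t₁).toSubring O ∧
        ∃ x' : Fin d → locAtCentre (Algebra.adjoin S t₁).toSubring O,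
          (∀ c, c ≠ b → (x' c : E) = (x c : E)) ∧
          (haveI := isLocalRing_locAtCentre hT₁O
           Ideal.span (Set.range x') = maximalIdeal _) ∧
          ∀ α : Fin d → ℕ, (∏ c, (x c : E) ^ α c) =
            ((x b : E) / (x a : E)) ^ α b *
              ∏ c, (x' c : E) ^ Function.update (Function.update α a (α a + α b)) b 0 c := by
  classical
  set z : E := (x b : E) / (x a : E) with hzdef
  obtain ⟨hT₁O, hreg₁, -, x', hx'c, hspan, hmono⟩ :=
    exists_frameStep_of_valuation_eq_one hSuc hinj O hSO hdom hres hSdim t ht hTO hreg x hx a b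
      hab h1
  obtain ⟨y, hy, s, hs, hvs, hzs⟩ := hzf
  have hzO : z ∈ O := (O.valuation_le_one_iff _).mp h1.le
  have hs0 : s ≠ 0 := ne_zero_of_valuation_eq_one hvs
  have hfzs : f * (z * s) = y := by
    have : z * f = y / s := hzs
    rw [← mul_assoc, mul_comm f z, this, div_mul_cancel₀ _ hs0]
  have hEq := locAtCentre_adjoin_insert_mul_eq' O t z s hs hvs
  have hT₂O : (Algebra.adjoin S (insert (z * s) t)).toSubring ≤ O.toSubring := by
    refine model_toSubring_le_valuationSubring O hSO (fun w hw => ?_)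
    rcases hw with rfl | hw
    · exact O.mul_mem _ _ hzO (hTO hs)
    · exact hTO (Algebra.subset_adjoin hw)
  obtain ⟨x'', hx''E, hspan''⟩ := transport_rsop O hT₁O hT₂O hEq.symm x' hspan
  have hzmem : z ∈ locAtCentre (Algebra.adjoin S (insert (z * s) t)).toSubring O := by
    rw [hEq]
    exact le_locAtCentre _ _ (Algebra.subset_adjoin (Set.mem_insert _ _))
  have hRF := locAtCentre_adjoin_le_subfield O t F hSF htF
  have hzsF : z * s ∈ F :=
    F.mul_mem (F.div_mem (hRF (x b).2) (hRF (x a).2)) (hRF (le_locAtCentre _ _ hs))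
  refine ⟨insert (z * s) t, Set.subset_insert _ _, ht.insert _, Set.insert_subset hzsF htF, ?_,
    hT₂O, ?_, hzmem, x'', fun c hc => by rw [hx''E]; exact hx'c c hc, hspan'',
    fun α => by simp_rw [hx''E]; exact hmono α⟩
  · rintro w (rfl | hw)
    · obtain ⟨n, hn⟩ := exists_pow_mul_mem_of_mem_adjoin' R₀ hSR₀ hfR₀ t hTR hy
      refine ⟨n + 1, ?_⟩
      rw [pow_succ, mul_assoc, hfzs]
      exact hn
    · exact hTR w hw
  · rw [hEq]; exact hreg₁

end Tracked

end Literature.AlgebraicGeometry.Resolution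

end
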